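import Summits.QuantumFields.QCD.Theorems.RobustYangMills.Negative.GlobalActivity
import HarnessLib

/-!
# `RobustYangMillsRG` — negative side, part A: the pure Haar weight passes the RP clause

Support lemma for the disproof of the crux `RobustYangMillsRG` (stmt-QuantumFields-14958, routes
`NestedDissectionSea` / `HeavyThresholdYMBridge`): the constant fine-torus weight `w ≡ 1`
(independent Haar links, i.e. Wilson's theory at `β = 0`) satisfies the reflection-positivity
clause of the admissibility predicate `AdmAt` of the crux on every odd torus `(ℤ/(2S+1))^d`,
`S ≥ 1`: for every bounded measurable real positive-time observable `F`
(`IsPositiveTimeObservable`, link reflection `θ t = 1 - t` of Wave 0),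
`0 ≤ ∫ F(ΘU) F(U) ∏ dU_e`. It is the `β = 0` case of the tree's PROVED odd-torus reflection
positivity `wilsonExpectation_oddReflectionPositive` (the positive-time edges of Wave 0 are a
subset of `WilsonOddRP.oPosEdges`; `β = 0` Wilson measure = product Haar is the predecessor crux's
`RobustYangMills.Negative.wilsonMeasure_zero_eq_pi`). [folklore]
-/

namespace Summit.QuantumFields.QCD.Theorems.RobustYangMillsRG.Negative

open MeasureTheory Literature.MathematicalPhysics.QuantumFieldTheory
open scoped ComplexOrder ComplexConjugate

/-- A positive-time observable of Wave 0 depends only on the links of `P ∪ M` of the odd-torus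
reflection-positivity theorem. [folklore] -/
theorem dependsOn_of_isPositiveTimeObservable {d L : ℕ} {G : Type*} [NeZero d] [NeZero L]
    {α : Type*} {F : GaugeConfig d L G → α} (hF : IsPositiveTimeObservable F) :
    DependsOn F ((WilsonOddRP.oPosEdges ∪ WilsonOddRP.oSharedEdges : Finset (Edge d L)) :
      Set (Edge d L)) := by
  intro U V hUV
  refine hF U V fun e h1 h2 _ _ => hUV e ?_
  rw [Finset.coe_union, Set.mem_union]
  left
  exact Finset.mem_coe.2 (WilsonOddRP.mem_oPosEdges.2 ⟨h1, h2⟩)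

variable {d L N : ℕ} {G : Type*} [Group G] [TopologicalSpace G] [IsTopologicalGroup G]
  [CompactSpace G] [MeasurableSpace G] [BorelSpace G]

/-- **The Haar weight `w ≡ 1` passes the RP clause of `AdmAt`** on the odd torus `(ℤ/(2S+1))^d`,
`S ≥ 1`: for every bounded measurable real positive-time observable `F`,
`0 ≤ ∫ F(ΘU) · F(U) ∏ₑ dU_e` under the product Haar probability measure. [folklore] -/
theorem haarWeight_reflectionPositive [NeZero d] {S : ℕ} (hS : 1 ≤ S)
    (F : GaugeConfig d (2 * S + 1) G → ℝ) (hF : Measurable F) (hFb : ∃ C, ∀ U, |F U| ≤ C)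
    (hpos : IsPositiveTimeObservable F) :
    0 ≤ ∫ U, F (GaugeConfig.timeReflect U) * F U ∂(Measure.pi fun _ : Edge d (2 * S + 1) => haarProbability G) := by
  -- the trivial `0 × 0` representation: at `β = 0` the representation plays no role
  set ρ : G →* Matrix (Fin 0) (Fin 0) ℂ := 1 with hρdef
  have hρ : Continuous ρ := continuous_const
  have hodd : Odd (2 * S + 1) := ⟨S, rfl⟩
  have h3 : 3 ≤ 2 * S + 1 := by omega
  obtain ⟨C, hC⟩ := hFb
  have key := wilsonExpectation_oddReflectionPositive (d := d) (L := 2 * S + 1) ρ hodd h3 hρ le_rfl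
    (fun U => (F U : ℂ)) (Complex.measurable_ofReal.comp hF)
    ⟨C, fun U => by rw [Complex.norm_real, Real.norm_eq_abs]; exact hC U⟩
    (fun U V h => congrArg (fun x : ℝ => (x : ℂ)) (dependsOn_of_isPositiveTimeObservable hpos h))
  rw [wilsonExpectation, RobustYangMills.Negative.wilsonMeasure_zero_eq_pi] at key
  have hint : (∫ U, conj ((F (GaugeConfig.timeReflect U) : ℝ) : ℂ) * ((F U : ℝ) : ℂ)
      ∂(Measure.pi fun _ : Edge d (2 * S + 1) => haarProbability G)) =
      ((∫ U, F (GaugeConfig.timeReflect U) * F U ∂(Measure.pi fun _ : Edge d (2 * S + 1) => haarProbability G) : ℝ) : ℂ) := by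
    rw [← integral_complex_ofReal]
    refine integral_congr_ae (ae_of_all _ fun U => ?_)
    simp only [Complex.conj_ofReal, Complex.ofReal_mul]
  rw [hint] at key
  exact Complex.zero_le_real.1 key

end Summit.QuantumFields.QCD.Theorems.RobustYangMillsRG.Negative
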